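import Summits.NavierStokesRegularity.NavierStokesRegularity.Theorems.CircuitPump.Negative.LoadBearing
import Literature.Analysis.ODE.OneSidedComparison

/-!
# `PerpetualPump.CircuitPump` (stmt-NavierStokesRegularity-1834), line `singular-clock-gspt`:
# the phase III clock (rise of the new bond at the next scale)

Sub-goal `toda_phase3_clock` of `stub_clockBox` (Toda `m = 2` instance). After the hop the pump's
energy sits in the new carrier `w ≈ W e^{-νt}` of the next scale, and the new bond `z` there obeys
`z' = z (lam (w - y) - ν) + s₁` on `[0,T]` with next precursor `|y| ≤ Y`, seed `0 ≤ s₁ ≤ Ps₁` and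
`|w - W e^{-νt}| ≤ Cw`. THE CLOCK of this phase: `log (z(t)/z(0)) = Φ(t) ± lam (Cw + Y) t`
(plus a seed correction in the upper bound), where `Φ(t) = lam W (1 - e^{-νt})/ν - νt` is the
primitive of the main part `lam W e^{-νt} - ν` of the growth rate `c = lam (w - y) - ν`,
`|c - Φ'| ≤ L := lam (Cw + Y)`.

Proof (pure real analysis, integral-free). Positivity: `z' ≥ c z` (variable-coefficient
comparison `Literature.Analysis.ODE.linearComparison_le`). Lower bound: `log z - Φ + L τ` is
non-decreasing (`(log z)' = c + s₁/z ≥ Φ' - L`). Upper bound (variation of constants):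
`H = z e^{-(Φ + Lτ)}` has `H' = e^{-(Φ + Lτ)} (z (c - Φ' - L) + s₁) ≤ Ps₁ e^{ντ} ≤ Ps₁ e^{(ν+L)t}`
on `[0,t]` (`Φ(τ) ≥ -ντ` as `W > 0`), so `z(t) e^{-(Φ(t) + Lt)} = H(t) ≤ z(0) + Ps₁ t e^{(ν+L)t}`.
[folklore]
-/

set_option linter.dupNamespace false

noncomputable section

open Set

namespace Summit.NavierStokesRegularity.NavierStokesRegularity.Theorems.PerpetualPumpCircuitPump

open Literature.Analysis.ODE

/-- Positivity of a scalar driven by a non-negative source: `z' = z c + s₁` with `s₁ ≥ 0`,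
`c` continuous and `z(0) > 0` gives `z > 0` on `[0,T]` (`z ≥ z(0) e^{∫ c}`). [folklore] -/
theorem phase3Clock_pos {T : ℝ} {z c s₁ : ℝ → ℝ} (hz0 : 0 < z 0)
    (hz : ContinuousOn z (Icc 0 T)) (hc : ContinuousOn c (Icc 0 T))
    (hz' : ∀ t ∈ Ico 0 T, HasDerivWithinAt z (z t * c t + s₁ t) (Ici t) t)
    (hs : ∀ t ∈ Icc 0 T, 0 ≤ s₁ t) : ∀ t ∈ Icc 0 T, 0 < z t := by
  intro t ht
  have h := linearComparison_le (A := fun _ => (0 : ℝ)) (β := c) hz hz' continuousOn_const hc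
    (fun x hx => by linarith [hs x (Ico_subset_Icc_self hx)]) ht
  simp only [zero_mul, intervalIntegral.integral_zero, add_zero] at h
  exact (mul_pos (Real.exp_pos _) hz0).trans_le h

/-- Lower clock bound: if `z' = z c + s₁` with `z > 0`, `s₁ ≥ 0` and `c ≥ Φ' - L`, then
`log z - Φ + L τ` is non-decreasing on `[0,T]`, i.e. `Φ(t) - L t ≤ log z(t) - log z(0)`
(`Φ(0) = 0`). [folklore] -/
theorem phase3Clock_lower {T L : ℝ} {z c s₁ Φ Φ' : ℝ → ℝ}
    (hz : ContinuousOn z (Icc 0 T))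
    (hz' : ∀ t ∈ Ico 0 T, HasDerivWithinAt z (z t * c t + s₁ t) (Ici t) t)
    (hzp : ∀ t ∈ Icc 0 T, 0 < z t) (hs : ∀ t ∈ Icc 0 T, 0 ≤ s₁ t)
    (hΦ : ∀ τ, HasDerivAt Φ (Φ' τ) τ) (hΦ0 : Φ 0 = 0)
    (hc : ∀ τ ∈ Ico 0 T, Φ' τ - L ≤ c τ) :
    ∀ t ∈ Icc 0 T, Φ t - L * t ≤ Real.log (z t) - Real.log (z 0) := by
  intro t ht
  have hG' : ∀ x ∈ Ico 0 T, HasDerivWithinAt (fun τ => Real.log (z τ) - Φ τ + L * τ)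
      ((z x * c x + s₁ x) / z x - Φ' x + L * 1) (Ici x) x := fun x hx =>
    (((hz' x hx).log (hzp x (Ico_subset_Icc_self hx)).ne').fun_sub
      (hΦ x).hasDerivWithinAt).fun_add (((hasDerivAt_id' x).const_mul L).hasDerivWithinAt)
  have hΦc : ContinuousOn Φ (Icc 0 T) := fun x _ => (hΦ x).continuousAt.continuousWithinAt
  have hGc : ContinuousOn (fun τ => Real.log (z τ) - Φ τ + L * τ) (Icc 0 T) :=
    ((hz.log fun x hx => (hzp x hx).ne').sub hΦc).add (by fun_prop)
  have h := le_of_deriv_right_nonneg hGc hG' (fun x hx => by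
    have hzx := hzp x (Ico_subset_Icc_self hx)
    have hsx := hs x (Ico_subset_Icc_self hx)
    have h1 : c x ≤ (z x * c x + s₁ x) / z x := by
      rw [le_div_iff₀ hzx]; nlinarith
    linarith [hc x hx]) t ht
  simp only [hΦ0, mul_zero, sub_zero, add_zero] at h
  linarith

/-- Upper clock bound (variation of constants): if `z' = z c + s₁` with `z > 0`, `0 ≤ s₁ ≤ Ps₁`,
`c ≤ Φ' + L` and `Φ(τ) + L τ ≥ -K τ` (`K ≥ 0`), then `H = z e^{-(Φ + Lτ)}` has
`H' ≤ Ps₁ e^{-(Φ + Lτ)} ≤ Ps₁ e^{K t}` on `[0,t]`, whence `z(t) e^{-(Φ(t) + Lt)} ≤ z(0) + Ps₁ t e^{Kt}`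
(`Φ(0) = 0`). [folklore] -/
theorem phase3Clock_upper {T L K Ps₁ : ℝ} {z c s₁ Φ Φ' : ℝ → ℝ}
    (hz : ContinuousOn z (Icc 0 T))
    (hz' : ∀ t ∈ Ico 0 T, HasDerivWithinAt z (z t * c t + s₁ t) (Ici t) t)
    (hzp : ∀ t ∈ Icc 0 T, 0 < z t) (hs : ∀ t ∈ Icc 0 T, 0 ≤ s₁ t ∧ s₁ t ≤ Ps₁)
    (hΦ : ∀ τ, HasDerivAt Φ (Φ' τ) τ) (hΦ0 : Φ 0 = 0)
    (hc : ∀ τ ∈ Ico 0 T, c τ ≤ Φ' τ + L) (hK : ∀ τ ∈ Icc 0 T, -(K * τ) ≤ Φ τ + L * τ)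
    (hK0 : 0 ≤ K) :
    ∀ t ∈ Icc 0 T, z t * Real.exp (-(Φ t + L * t)) ≤ z 0 + Ps₁ * t * Real.exp (K * t) := by
  intro t ht
  have hI : Icc 0 t ⊆ Icc 0 T := Icc_subset_Icc_right ht.2
  have hI' : ∀ x ∈ Ico 0 t, x ∈ Ico 0 T := fun x hx => ⟨hx.1, hx.2.trans_le ht.2⟩
  have hH' : ∀ x ∈ Ico 0 t, HasDerivWithinAt (fun τ => z τ * Real.exp (-(Φ τ + L * τ)))
      ((z x * c x + s₁ x) * Real.exp (-(Φ x + L * x)) +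
        z x * (Real.exp (-(Φ x + L * x)) * -(Φ' x + L * 1))) (Ici x) x := fun x hx =>
    (hz' x (hI' x hx)).fun_mul
      (((hΦ x).fun_add ((hasDerivAt_id' x).const_mul L)).fun_neg.exp.hasDerivWithinAt)
  have hΦc : ContinuousOn Φ (Icc 0 t) := fun x _ => (hΦ x).continuousAt.continuousWithinAt
  have hHc : ContinuousOn (fun τ => z τ * Real.exp (-(Φ τ + L * τ))) (Icc 0 t) :=
    (hz.mono hI).mul ((hΦc.add (by fun_prop)).neg.rexp)
  have h := sub_le_mul_of_deriv_right_le (M := Ps₁ * Real.exp (K * t)) hHc hH' (fun x hx => by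
    have hzx := hzp x (Ico_subset_Icc_self (hI' x hx))
    have hsx := hs x (Ico_subset_Icc_self (hI' x hx))
    have hE : Real.exp (-(Φ x + L * x)) ≤ Real.exp (K * t) := by
      apply Real.exp_le_exp.mpr
      have h1 := hK x (Ico_subset_Icc_self (hI' x hx))
      have h2 : K * x ≤ K * t := mul_le_mul_of_nonneg_left hx.2.le hK0
      linarith
    have hEp := Real.exp_pos (-(Φ x + L * x))
    have h3 : z x * (c x - Φ' x - L) ≤ 0 :=
      mul_nonpos_of_nonneg_of_nonpos hzx.le (by linarith [hc x (hI' x hx)])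
    have hPs : 0 ≤ Ps₁ := hsx.1.trans hsx.2
    calc (z x * c x + s₁ x) * Real.exp (-(Φ x + L * x)) +
          z x * (Real.exp (-(Φ x + L * x)) * -(Φ' x + L * 1))
        = Real.exp (-(Φ x + L * x)) * (z x * (c x - Φ' x - L) + s₁ x) := by ring
      _ ≤ Real.exp (-(Φ x + L * x)) * Ps₁ :=
          mul_le_mul_of_nonneg_left (by linarith [hsx.2]) hEp.le
      _ ≤ Real.exp (K * t) * Ps₁ := mul_le_mul_of_nonneg_right hE hPs
      _ = Ps₁ * Real.exp (K * t) := mul_comm _ _) t ⟨ht.1, le_rfl⟩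
  simp only [hΦ0, mul_zero, add_zero, neg_zero, Real.exp_zero, mul_one, sub_zero] at h
  linarith

/-- The comparison exponent `Φ(τ) = lam W (1 - e^{-ντ})/ν - ντ` has derivative
`lam W e^{-ντ} - ν` (`ν ≠ 0`). [folklore] -/
theorem phase3Clock_hasDerivAt_phi {lam W ν : ℝ} (hν : ν ≠ 0) (τ : ℝ) :
    HasDerivAt (fun x => lam * W * (1 - Real.exp (-ν * x)) / ν - ν * x)
      (lam * W * Real.exp (-ν * τ) - ν) τ := by
  refine (((((hasDerivAt_id' τ).const_mul (-ν)).exp.const_sub 1).const_mul (lam * W)).div_const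
    ν |>.sub ((hasDerivAt_id' τ).const_mul ν)).congr_deriv ?_
  field_simp

/-- **PHASE III CLOCK (the new bond's rise at the next scale).** New bond `z` at scale `1`
(`z' = z·(lam (w − y) − ν) + s₁`, seed `s₁ ∈ [0, Ps₁]`), new carrier `w` tracked by a decaying exponential
(`|w(t) − W e^{−νt}| ≤ Cw`, as delivered by `toda_gate_R` (b) + `toda_gate_sigma`), next precursor `|y| ≤ Y`: the
accumulated growth exponent of `z` is `lam ∫ w − ν t ± lam (Cw + Y) t`, i.e.
`log(z(t)/z(0)) = lam W (1 − e^{−νt})/ν − νt ± O(t)` (+ a seed correction in the upper bound). -/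
theorem toda_phase3_clock :
    ∀ (lam ν W Cw Y Ps₁ T : ℝ) (w z y s₁ : ℝ → ℝ),
    1 < lam → lam ≤ 2 → ν = lam ^ (4 / 5 : ℝ) → 0 ≤ Cw → 0 ≤ Y → 0 ≤ Ps₁ → 0 < T → 0 < W →
    0 < z 0 →
    ContinuousOn w (Set.Icc 0 T) → ContinuousOn z (Set.Icc 0 T) → ContinuousOn y (Set.Icc 0 T) →
    ContinuousOn s₁ (Set.Icc 0 T) →
    (∀ t ∈ Set.Ico 0 T, HasDerivWithinAt z (z t * (lam * (w t - y t) - ν) + s₁ t) (Set.Ici t) t) →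
    (∀ t ∈ Set.Icc 0 T, |w t - W * Real.exp (-ν * t)| ≤ Cw) →
    (∀ t ∈ Set.Icc 0 T, |y t| ≤ Y) →
    (∀ t ∈ Set.Icc 0 T, 0 ≤ s₁ t ∧ s₁ t ≤ Ps₁) →
    ∀ t ∈ Set.Icc 0 T,
      0 < z t ∧
      lam * W * (1 - Real.exp (-ν * t)) / ν - ν * t - lam * (Cw + Y) * t ≤ Real.log (z t / z 0) ∧
      Real.log (z t / z 0) ≤ lam * W * (1 - Real.exp (-ν * t)) / ν - ν * t + lam * (Cw + Y) * t +
        Real.log (1 + Ps₁ * t * Real.exp ((ν + lam * (Cw + Y)) * t) / z 0) := by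
  intro lam ν W Cw Y Ps₁ T w z y s₁ hlam _ hν hCw hY hPs hT hW hz0 hw hz hy _ hz' hwW hyY hs t ht
  have hν1 : 1 < ν := by rw [hν]; exact Real.one_lt_rpow hlam (by norm_num)
  have hν0 : 0 < ν := one_pos.trans hν1
  have hlam0 : 0 < lam := one_pos.trans hlam
  have hL : 0 ≤ lam * (Cw + Y) := mul_nonneg hlam0.le (add_nonneg hCw hY)
  have hΦ := fun τ => phase3Clock_hasDerivAt_phi (lam := lam) (W := W) hν0.ne' τ
  have hΦ0 : (fun x => lam * W * (1 - Real.exp (-ν * x)) / ν - ν * x) 0 = 0 := by simp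
  have hc : ContinuousOn (fun τ => lam * (w τ - y τ) - ν) (Icc 0 T) :=
    (continuousOn_const.mul (hw.sub hy)).sub continuousOn_const
  have hs0 : ∀ τ ∈ Icc 0 T, 0 ≤ s₁ τ := fun τ hτ => (hs τ hτ).1
  have hzp : ∀ τ ∈ Icc 0 T, 0 < z τ :=
    phase3Clock_pos (c := fun τ => lam * (w τ - y τ) - ν) hz0 hz hc hz' hs0
  -- the growth rate is `Φ' ± L`
  have hcb : ∀ τ ∈ Icc 0 T, |lam * (w τ - y τ) - ν - (lam * W * Real.exp (-ν * τ) - ν)| ≤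
      lam * (Cw + Y) := by
    intro τ hτ
    have h1 := hwW τ hτ
    have h2 := hyY τ hτ
    have e : lam * (w τ - y τ) - ν - (lam * W * Real.exp (-ν * τ) - ν) =
        lam * ((w τ - W * Real.exp (-ν * τ)) - y τ) := by ring
    rw [e, abs_mul, abs_of_pos hlam0]
    exact mul_le_mul_of_nonneg_left ((abs_sub _ _).trans (add_le_add h1 h2)) hlam0.le
  have hlo := phase3Clock_lower (L := lam * (Cw + Y)) (c := fun τ => lam * (w τ - y τ) - ν)
    hz hz' hzp hs0 hΦ hΦ0
    (fun τ hτ => by have := (abs_le.mp (hcb τ (Ico_subset_Icc_self hτ))).1; linarith) t ht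
  have hup := phase3Clock_upper (L := lam * (Cw + Y)) (K := ν + lam * (Cw + Y))
    (c := fun τ => lam * (w τ - y τ) - ν) hz hz' hzp hs hΦ hΦ0
    (fun τ hτ => by have := (abs_le.mp (hcb τ (Ico_subset_Icc_self hτ))).2; linarith)
    (fun τ hτ => by
      have he : Real.exp (-ν * τ) ≤ 1 := by
        rw [Real.exp_le_one_iff]; nlinarith [hτ.1]
      have h1 : 0 ≤ lam * W * (1 - Real.exp (-ν * τ)) / ν :=
        div_nonneg (mul_nonneg (mul_nonneg hlam0.le hW.le) (by linarith)) hν0.le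
      have h2 : 0 ≤ lam * (Cw + Y) * τ := mul_nonneg hL hτ.1
      nlinarith)
    (add_nonneg hν0.le hL) t ht
  have hzt := hzp t ht
  have hlog : Real.log (z t / z 0) = Real.log (z t) - Real.log (z 0) :=
    Real.log_div hzt.ne' hz0.ne'
  refine ⟨hzt, ?_, ?_⟩
  · rw [hlog]; linarith
  · have hq : 0 < 1 + Ps₁ * t * Real.exp ((ν + lam * (Cw + Y)) * t) / z 0 := by
      have := ht.1; positivity
    rw [Real.log_le_iff_le_exp (div_pos hzt hz0), Real.exp_add, Real.exp_log hq, div_le_iff₀ hz0]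
    set E : ℝ := lam * W * (1 - Real.exp (-ν * t)) / ν - ν * t + lam * (Cw + Y) * t with hE
    have h1 : Real.exp E * Real.exp (-E) = 1 := by
      rw [← Real.exp_add, add_neg_cancel, Real.exp_zero]
    have hup' : z t * Real.exp (-E) ≤ z 0 + Ps₁ * t * Real.exp ((ν + lam * (Cw + Y)) * t) := by
      have e : -E = -(lam * W * (1 - Real.exp (-ν * t)) / ν - ν * t + lam * (Cw + Y) * t) := by
        rw [hE]
      rw [e]; exact hup
    have h3 : Real.exp E * (1 + Ps₁ * t * Real.exp ((ν + lam * (Cw + Y)) * t) / z 0) * z 0 =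
        Real.exp E * (z 0 + Ps₁ * t * Real.exp ((ν + lam * (Cw + Y)) * t)) := by
      field_simp
    rw [h3]
    calc z t = Real.exp E * Real.exp (-E) * z t := by rw [h1, one_mul]
      _ = Real.exp E * (z t * Real.exp (-E)) := by ring
      _ ≤ _ := mul_le_mul_of_nonneg_left hup' (Real.exp_pos E).le

end Summit.NavierStokesRegularity.NavierStokesRegularity.Theorems.PerpetualPumpCircuitPump
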